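import Mathlib

/-!
# Skew-cut certificate: uniform energy / graph-norm bounds of Galerkin eigenvectors from the
section structure (instab3 g3, cell `ns-blowup`, 2026-08-26)

HONEST FRAMING (human ruling D-0035): nothing here is a claim about Navier–Stokes blow-up.
WHAT THIS IS NOT: not NS evidence. Companion of `SkewCutSchurCoercivity.lean` (finite half of the
skew-cut chain: certified numbers + structure ⇒ a real Galerkin eigenvalue `x_n ∈ (x₁, x₂)` of EVERY
section `L_n`) and of instab4's `SkewCutGalerkinLimit.lean` (Theorem 2 (ii) of
`selfsim/SKEWCUT-CERT.md`: limits of Galerkin eigenpairs are eigenpairs of the infinite operator,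
GIVEN a uniform bound `‖(x₀ − L) v_n‖ ≤ C` on the normalised Galerkin eigenvectors — the note's
ENERGY and H²-BOUND lines). This file proves that uniform bound at the MATRIX level, from the same
structural hypotheses as STEP 2, so that it too stops being prose.

## Setting

By locality (the MODEL operator «NS linearised about the forced ABC flow» is shell-block-tridiagonal
in Fourier–Craya variables, SKEWCUT-CERT (F3)), for a Galerkin eigenvector `v_n ∈ range P_n` the
vector `(x₀ − L) v_n` lies in `range P_{n+1}` and equals the `(n+1)`-SECTION matrix applied to `v_n`.
So everything is a statement about ONE real matrix family on the index type `a ⊕ b`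
(`a` = modes of shells `≤ n`, `b` = shell `n+1`):

  `M(x) = diagonal (x + ν κ) + G + F`,  `κ_k = |k|²`,

with `Gᵀ = −G` ((F1) skew advection), `vᵀ F v ≥ −s·vᵀv` ((F2), `s = √2`), and the two NORM bounds
`‖G v‖² ≤ c_G² Σ κᵢ vᵢ²` (`‖P(U·∇)v‖ ≤ ‖U‖_∞ ‖∇v‖`) and `‖F v‖² ≤ c_F² ‖v‖²`
(`‖P(v·∇)U‖ ≤ ‖∇U‖_∞ ‖v‖`). The Galerkin eigen-relation `L_n u = x u` reads: `v := (u, 0)` and the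
`a`-components of `M(x) v` vanish.

## Results

* `dotProduct_mulVec_eq_zero_of_transpose_eq_neg'` — skew ⇒ zero form (restated to keep this file
  Mathlib-only).
* `energy_bound` — ENERGY: `vᵀ M(x) v = 0`, `G` skew, `F ≥ −s` ⇒ `ν Σ κᵢ vᵢ² ≤ (s − x)·vᵀv`
  (the note's `ν‖∇v_n‖² ≤ s − x₁`).
* `galerkin_form_eq_zero` — for `v = (u, 0)` with `(M(x) v)_a = 0`: `vᵀ M(x) v = 0`.
* `galerkin_residual_eq` — for such `v`: `‖M(x) v‖² = Σ_b ((G + F) v)_j²` (the diagonal part and the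
  `a`-components drop out), hence `≤ ‖(G + F) v‖²`.
* `inl_mulVec_eq_zero_of_eigen` — packaging: head block `x·1 − L_n` and `L_n u = x u` ⇒ the
  `a`-components of `M(x)(u,0)` vanish (the hypothesis of the next item).
* `graph_bound` — H²-BOUND: `‖M(x₀) v‖² ≤ (2(x₀ − x)² + 4(c_G²·(s − x)/ν + c_F²))·‖v‖²`; with
  `x ∈ [x₁, x₂]` this is the uniform `‖(x₀ − L) v_n‖ ≤ C ‖v_n‖` consumed by
  `SkewCutGalerkinLimit.galerkin_eigenpair_limit` (`w_n = M(x₀) v_n`, `‖v_n‖ = 1`).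

What stays model-specific after this file and its two companions: that the assembled class-II
sections have this structure with `s = √2`, `c_G = ‖U‖_∞`, `c_F = ‖∇U‖_∞` (Fourier–Craya
bookkeeping), compactness of the resolvent, the class restriction (referee P3), elliptic regularity
to `Literature.Analysis.FluidPDE.Torus.IsLinNSEigenvalue`, and the certifiers' verified arithmetic.
Mathlib only; no definitions; all norms are written as dot products (`yᵀy`).
-/

namespace Summit.NavierStokesRegularity.FluidComputer.SkewCutGalerkinBounds

open Matrix Finset

section Energy

variable {ι : Type*} [Fintype ι] [DecidableEq ι]

omit [DecidableEq ι] in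
/-- A real skew matrix has vanishing quadratic form (`Gᵀ = −G ⇒ vᵀGv = 0`). -/
theorem dotProduct_mulVec_eq_zero_of_transpose_eq_neg' (G : Matrix ι ι ℝ) (hG : Gᵀ = -G)
    (v : ι → ℝ) : v ⬝ᵥ (G *ᵥ v) = 0 := by
  have h1 : v ⬝ᵥ (G *ᵥ v) = -(v ⬝ᵥ (G *ᵥ v)) :=
    calc v ⬝ᵥ (G *ᵥ v) = (v ᵥ* G) ⬝ᵥ v := dotProduct_mulVec v G v
      _ = (Gᵀ *ᵥ v) ⬝ᵥ v := by rw [mulVec_transpose]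
      _ = -(v ⬝ᵥ (G *ᵥ v)) := by rw [hG, neg_mulVec, neg_dotProduct, dotProduct_comm]
  linarith

/-- The diagonal form: `vᵀ diagonal(x + ν κ) v = x·vᵀv + ν Σ κᵢ vᵢ²`. -/
theorem dotProduct_diagonal_mulVec (κ : ι → ℝ) (x ν : ℝ) (v : ι → ℝ) :
    v ⬝ᵥ (diagonal (fun i => x + ν * κ i) *ᵥ v) = x * (v ⬝ᵥ v) + ν * ∑ i, κ i * v i ^ 2 := by
  unfold dotProduct
  rw [Finset.mul_sum, Finset.mul_sum, ← Finset.sum_add_distrib]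
  refine Finset.sum_congr rfl fun i _ => ?_
  rw [mulVec_diagonal]
  ring

/-- **ENERGY bound.** If `vᵀ M(x) v = 0` for `M(x) = diagonal(x + ν κ) + G + F` with `G` skew and
`vᵀFv ≥ −s·vᵀv`, then `ν Σ κᵢ vᵢ² ≤ (s − x)·vᵀv` (SKEWCUT-CERT §4 (ii): `ν‖∇v_n‖² ≤ s − x_n`). -/
theorem energy_bound (κ : ι → ℝ) (G F : Matrix ι ι ℝ) (ν s x : ℝ) (hG : Gᵀ = -G)
    (hF : ∀ v : ι → ℝ, -(s * (v ⬝ᵥ v)) ≤ v ⬝ᵥ (F *ᵥ v)) (v : ι → ℝ)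
    (hv : v ⬝ᵥ ((diagonal (fun i => x + ν * κ i) + G + F) *ᵥ v) = 0) :
    ν * ∑ i, κ i * v i ^ 2 ≤ (s - x) * (v ⬝ᵥ v) := by
  rw [add_mulVec, add_mulVec, dotProduct_add, dotProduct_add, dotProduct_diagonal_mulVec,
    dotProduct_mulVec_eq_zero_of_transpose_eq_neg' G hG v] at hv
  linarith [hF v]

end Energy

section Galerkin

variable {a b : Type*} [Fintype a] [Fintype b] [DecidableEq a] [DecidableEq b]

omit [DecidableEq a] [DecidableEq b] in
/-- Splitting a dot product over `a ⊕ b`. -/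
theorem dotProduct_sum_split' (v y : a ⊕ b → ℝ) :
    v ⬝ᵥ y = (fun i => v (Sum.inl i)) ⬝ᵥ (fun i => y (Sum.inl i)) +
      (fun j => v (Sum.inr j)) ⬝ᵥ (fun j => y (Sum.inr j)) := by
  unfold dotProduct
  rw [Fintype.sum_sum_type]

omit [DecidableEq a] [DecidableEq b] in
/-- **Galerkin eigen-relation ⇒ zero form.** If `v = (u, 0)` and the `a`-components of `M v` vanish
(`P_n (x − L) v_n = 0` for `v_n ∈ range P_n`), then `vᵀ M v = 0`. -/
theorem galerkin_form_eq_zero (M : Matrix (a ⊕ b) (a ⊕ b) ℝ) (u : a → ℝ)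
    (hu : ∀ i : a, (M *ᵥ Sum.elim u 0) (Sum.inl i) = 0) :
    Sum.elim u 0 ⬝ᵥ (M *ᵥ Sum.elim u 0) = 0 := by
  rw [dotProduct_sum_split']
  have h1 : (fun i => (M *ᵥ Sum.elim u 0) (Sum.inl i)) = 0 := funext hu
  rw [h1, dotProduct_zero]
  simp [dotProduct]

/-- **The Galerkin residual.** For `v = (u, 0)` with vanishing `a`-components of `M(x) v`,
`M(x) = diagonal d + G + F`: `‖M(x) v‖² = Σ_{j ∈ b} ((G + F) v)_j²` — the diagonal part lives on `a`
(where the components vanish) and contributes nothing on `b` (where `v` vanishes). -/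
theorem galerkin_residual_eq (d : a ⊕ b → ℝ) (G F : Matrix (a ⊕ b) (a ⊕ b) ℝ) (u : a → ℝ)
    (hu : ∀ i : a, ((diagonal d + G + F) *ᵥ Sum.elim u 0) (Sum.inl i) = 0) :
    ((diagonal d + G + F) *ᵥ Sum.elim u 0) ⬝ᵥ ((diagonal d + G + F) *ᵥ Sum.elim u 0) =
      (fun j => ((G + F) *ᵥ Sum.elim u 0) (Sum.inr j)) ⬝ᵥ
        (fun j => ((G + F) *ᵥ Sum.elim u 0) (Sum.inr j)) := by
  rw [dotProduct_sum_split']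
  have h1 : (fun i => ((diagonal d + G + F) *ᵥ Sum.elim u 0) (Sum.inl i)) = 0 := funext hu
  have h2 : (fun j => ((diagonal d + G + F) *ᵥ Sum.elim u 0) (Sum.inr j)) =
      fun j => ((G + F) *ᵥ Sum.elim u 0) (Sum.inr j) := by
    funext j
    rw [add_assoc, add_mulVec, Pi.add_apply, mulVec_diagonal, Sum.elim_inr, Pi.zero_apply, mul_zero,
      zero_add]
  rw [h1, h2, dotProduct_zero, zero_add]

omit [DecidableEq a] [DecidableEq b] in
/-- The `b`-part of a vector has dot-square at most the whole: `Σ_b y_j² ≤ yᵀy`. -/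
theorem dotProduct_inr_le (y : a ⊕ b → ℝ) :
    (fun j => y (Sum.inr j)) ⬝ᵥ (fun j => y (Sum.inr j)) ≤ y ⬝ᵥ y := by
  rw [dotProduct_sum_split' y y]
  have : 0 ≤ (fun i => y (Sum.inl i)) ⬝ᵥ (fun i => y (Sum.inl i)) := by
    unfold dotProduct
    exact Finset.sum_nonneg fun i _ => mul_self_nonneg _
  linarith

omit [DecidableEq b] in
/-- **From the Galerkin eigenpair to the residual relation.** If the `(n+1)`-section at `x` has
head block `x·1 − L_n` (the `n`-section is the compression of the `(n+1)`-section; locality puts no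
condition on the other blocks) and `L_n u = x u`, then the `a`-components of `M(x) (u, 0)` vanish —
the hypothesis `hu` of `graph_bound` (the eigenpair itself comes from
`SkewCutSchurCoercivity.exists_eigenvalue_of_certificate`). -/
theorem inl_mulVec_eq_zero_of_eigen (M : Matrix (a ⊕ b) (a ⊕ b) ℝ) (Ln : Matrix a a ℝ)
    (B : Matrix a b ℝ) (C : Matrix b a ℝ) (D : Matrix b b ℝ) (x : ℝ) (u : a → ℝ)
    (hM : M = fromBlocks (x • (1 : Matrix a a ℝ) - Ln) B C D) (hu : Ln *ᵥ u = x • u) (i : a) :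
    (M *ᵥ Sum.elim u 0) (Sum.inl i) = 0 := by
  rw [hM, fromBlocks_mulVec, Sum.elim_inl, Sum.elim_comp_inl, Sum.elim_comp_inr, mulVec_zero,
    add_zero, sub_mulVec, smul_mulVec, one_mulVec, hu, sub_self, Pi.zero_apply]

/-- **H²/GRAPH-NORM bound (uniform in the section).** `M(x) := diagonal(x + ν κ) + G + F` on
`a ⊕ b` with `ν > 0`, `G` skew, `vᵀFv ≥ −s·vᵀv`, `‖Gv‖² ≤ c_G²·Σ κᵢvᵢ²`, `‖Fv‖² ≤ c_F²·vᵀv`. If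
`v = (u, 0)` is a Galerkin eigenvector, i.e. the `a`-components of `M(x) v` vanish, then
`‖M(x₀) v‖² ≤ (2(x₀ − x)² + 4(c_G²·(s − x)/ν + c_F²))·vᵀv`. In the certificate `x = x_n ∈ [x₁, x₂]`,
so `w_n := M(x₀) v_n = (x₀ − L) v_n` is uniformly bounded on normalised Galerkin eigenvectors — the
input `‖w_n‖ ≤ C` of `SkewCutGalerkinLimit.galerkin_eigenpair_limit`. -/
theorem graph_bound (κ : a ⊕ b → ℝ) (G F : Matrix (a ⊕ b) (a ⊕ b) ℝ) (ν s cG cF x₀ x : ℝ)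
    (hν : 0 < ν) (hG : Gᵀ = -G) (hF : ∀ v : a ⊕ b → ℝ, -(s * (v ⬝ᵥ v)) ≤ v ⬝ᵥ (F *ᵥ v))
    (hGb : ∀ v : a ⊕ b → ℝ, (G *ᵥ v) ⬝ᵥ (G *ᵥ v) ≤ cG ^ 2 * ∑ i, κ i * v i ^ 2)
    (hFb : ∀ v : a ⊕ b → ℝ, (F *ᵥ v) ⬝ᵥ (F *ᵥ v) ≤ cF ^ 2 * (v ⬝ᵥ v)) (u : a → ℝ)
    (hu : ∀ i : a, ((diagonal (fun i => x + ν * κ i) + G + F) *ᵥ Sum.elim u 0) (Sum.inl i) = 0) :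
    ((diagonal (fun i => x₀ + ν * κ i) + G + F) *ᵥ Sum.elim u 0) ⬝ᵥ
        ((diagonal (fun i => x₀ + ν * κ i) + G + F) *ᵥ Sum.elim u 0) ≤
      (2 * (x₀ - x) ^ 2 + 4 * (cG ^ 2 * ((s - x) / ν) + cF ^ 2)) *
        (Sum.elim u (0 : b → ℝ) ⬝ᵥ Sum.elim u (0 : b → ℝ)) := by
  set v : a ⊕ b → ℝ := Sum.elim u 0 with hv
  -- `‖y + z‖² ≤ 2‖y‖² + 2‖z‖²` (folklore; = `B4Ineq115Torus.add_dot_self_le`, inlined to keep imports local)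
  have add_sq : ∀ y z : a ⊕ b → ℝ, (y + z) ⬝ᵥ (y + z) ≤ 2 * (y ⬝ᵥ y) + 2 * (z ⬝ᵥ z) := by
    intro y z
    have h : 0 ≤ (y - z) ⬝ᵥ (y - z) := by
      unfold dotProduct
      exact Finset.sum_nonneg fun i _ => mul_self_nonneg _
    have e1 : (y + z) ⬝ᵥ (y + z) = y ⬝ᵥ y + 2 * (y ⬝ᵥ z) + z ⬝ᵥ z := by
      rw [add_dotProduct, dotProduct_add, dotProduct_add, dotProduct_comm z y]; ring
    have e2 : (y - z) ⬝ᵥ (y - z) = y ⬝ᵥ y - 2 * (y ⬝ᵥ z) + z ⬝ᵥ z := by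
      rw [sub_dotProduct, dotProduct_sub, dotProduct_sub, dotProduct_comm z y]; ring
    linarith
  -- energy
  have hE : ν * ∑ i, κ i * v i ^ 2 ≤ (s - x) * (v ⬝ᵥ v) :=
    energy_bound κ G F ν s x hG hF v
      (galerkin_form_eq_zero (diagonal (fun i => x + ν * κ i) + G + F) u hu)
  have hE' : ∑ i, κ i * v i ^ 2 ≤ (s - x) / ν * (v ⬝ᵥ v) := by
    rw [div_mul_eq_mul_div, le_div_iff₀ hν]; linarith
  -- the residual at x
  have hres : ((diagonal (fun i => x + ν * κ i) + G + F) *ᵥ v) ⬝ᵥ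
      ((diagonal (fun i => x + ν * κ i) + G + F) *ᵥ v) ≤
      2 * (cG ^ 2 * ((s - x) / ν) * (v ⬝ᵥ v)) + 2 * (cF ^ 2 * (v ⬝ᵥ v)) := by
    rw [hv, galerkin_residual_eq _ G F u hu, ← hv]
    calc (fun j => ((G + F) *ᵥ v) (Sum.inr j)) ⬝ᵥ (fun j => ((G + F) *ᵥ v) (Sum.inr j))
        ≤ ((G + F) *ᵥ v) ⬝ᵥ ((G + F) *ᵥ v) := dotProduct_inr_le _
      _ = (G *ᵥ v + F *ᵥ v) ⬝ᵥ (G *ᵥ v + F *ᵥ v) := by rw [add_mulVec]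
      _ ≤ 2 * ((G *ᵥ v) ⬝ᵥ (G *ᵥ v)) + 2 * ((F *ᵥ v) ⬝ᵥ (F *ᵥ v)) := add_sq _ _
      _ ≤ 2 * (cG ^ 2 * ((s - x) / ν) * (v ⬝ᵥ v)) + 2 * (cF ^ 2 * (v ⬝ᵥ v)) := by
          have h1 := hGb v
          have h2 := hFb v
          have h3 : cG ^ 2 * ∑ i, κ i * v i ^ 2 ≤ cG ^ 2 * ((s - x) / ν * (v ⬝ᵥ v)) :=
            mul_le_mul_of_nonneg_left hE' (sq_nonneg cG)
          nlinarith
  -- M(x₀) v = (x₀ - x) • v + M(x) v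
  have hsplit : (diagonal (fun i => x₀ + ν * κ i) + G + F) *ᵥ v =
      (x₀ - x) • v + (diagonal (fun i => x + ν * κ i) + G + F) *ᵥ v := by
    funext i
    simp only [add_mulVec, Pi.add_apply, Pi.smul_apply, mulVec_diagonal, smul_eq_mul]
    ring
  have hvv : ((x₀ - x) • v) ⬝ᵥ ((x₀ - x) • v) = (x₀ - x) ^ 2 * (v ⬝ᵥ v) := by
    rw [smul_dotProduct, dotProduct_smul, smul_eq_mul, smul_eq_mul]; ring
  rw [hsplit]
  calc ((x₀ - x) • v + (diagonal (fun i => x + ν * κ i) + G + F) *ᵥ v) ⬝ᵥ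
        ((x₀ - x) • v + (diagonal (fun i => x + ν * κ i) + G + F) *ᵥ v)
      ≤ 2 * (((x₀ - x) • v) ⬝ᵥ ((x₀ - x) • v)) +
          2 * (((diagonal (fun i => x + ν * κ i) + G + F) *ᵥ v) ⬝ᵥ
            ((diagonal (fun i => x + ν * κ i) + G + F) *ᵥ v)) := add_sq _ _
    _ ≤ (2 * (x₀ - x) ^ 2 + 4 * (cG ^ 2 * ((s - x) / ν) + cF ^ 2)) * (v ⬝ᵥ v) := by
          rw [hvv]; nlinarith [hres]

end Galerkin

end Summit.NavierStokesRegularity.FluidComputer.SkewCutGalerkinBounds
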